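import Mathlib.Analysis.Distribution.ContDiffMapSupportedIn
import Mathlib.Analysis.Calculus.UniformLimitsDeriv
import Mathlib.Topology.Metrizable.CompletelyMetrizable
import Mathlib.Topology.Baire.CompleteMetrizable
import Mathlib.Analysis.LocallyConvex.Barrelled
import HarnessLib

/-!
# The space `𝓓_K` of smooth functions supported in `K` is complete (a Fréchet space)

Topic `Literature/Analysis/FunctionSpaces`. All results are about Mathlib's
`ContDiffMapSupportedIn` (`𝓓_K`, fixed compact support `K`), *not* about the LF-space
`TestFunction` `𝓓(Ω, F)` (which is not metrizable); they live in `namespace Literature.ContDiffMapSupportedIn`.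
Mathlib (at the pin of this tree) has the space
`𝓓_{K}(E, F) = ContDiffMapSupportedIn E F ⊤ K` of smooth functions supported in a fixed compact
set `K`, with its locally convex topology defined by the sup norms of all iterated derivatives
(`ContDiffMapSupportedIn.withSeminorms`) and the uniform embedding
`f ↦ (Dⁱ f)ᵢ` into `Π i, E →ᵇ (E [×i]→L[ℝ] F)`
(`ContDiffMapSupportedIn.isUniformEmbedding_pi_structureMapCLM`), but not its completeness.
This file proves:

* `Literature.Analysis.FunctionSpaces.ContDiffMapSupportedIn.exists_of_tendsto_iteratedFDeriv`: if along a (non-trivial) filter the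
  iterated derivatives `Dⁱ uₐ` of test functions `uₐ ∈ 𝓓_K` converge uniformly, for every `i`,
  to bounded continuous `gᵢ`, then there is `f ∈ 𝓓_K` with `Dⁱ f = gᵢ` for all `i` (uniform
  limits commute with differentiation, `hasFDerivAt_of_tendstoUniformly`, assembled into a
  `HasFTaylorSeriesUpTo`);
* hence the range of the embedding is closed and **`𝓓_K` is complete**
  (`Literature.Analysis.FunctionSpaces.ContDiffMapSupportedIn.instCompleteSpace`), and its uniformity is countably generated
  (`Literature.Analysis.FunctionSpaces.ContDiffMapSupportedIn.instIsCountablyGenerated_uniformity`), so `𝓓_K` is completely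
  pseudo-metrizable; Mathlib then derives that it is a **Baire space** and a **barrelled space**
  (`BaireSpace.of_completelyPseudoMetrizable`, `BaireSpace.instBarrelledSpace`; no instances are
  declared here for these two classes, only `example`s), which makes the uniform boundedness
  principle `WithSeminorms.banach_steinhaus` available on `𝓓_K`.

This is the statement "`𝒟_K` is a Fréchet space" (W. Rudin, *Functional Analysis* (2nd ed.
1991), §1.46: "Thus `C^∞(Ω)` is a Fréchet space. The same is true of each of its closed subspaces
`𝒟_K`"; L. Schwartz, *Théorie des distributions* (1966), Ch. III §1); its use: the
Banach–Steinhaus theorem for distributions (Rudin, Thm. 2.6 with §6.5–6.8), needed for the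
uniqueness of distributional boundary values of holomorphic functions (planned consumer:
the fact `eq_zero_of_distributionalBoundaryValue_zero` of the `QuantumLattice/SchwingerWightman`
cluster).

## References

* W. Rudin, *Functional Analysis*, 2nd ed., McGraw-Hill (1991), §1.46 (pdf p. 29 of the held
  copy), Thm. 2.6 (Banach–Steinhaus), §6.2–6.5. [Rudin1991]
* L. Schwartz, *Théorie des distributions*, Hermann (1966), Ch. III, §1.

## Mathlib

Used: `ContDiffMapSupportedIn` (`structureMapCLM`, `isUniformEmbedding_pi_structureMapCLM`,
`iteratedFDeriv_zero_on_compl`), `hasFDerivAt_of_tendstoUniformly`, `HasFTaylorSeriesUpTo`,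
`HasFTaylorSeriesUpToOn.eq_iteratedFDerivWithin_of_uniqueDiffOn`,
`continuousMultilinearCurryLeftEquiv`, `BoundedContinuousFunction.tendsto_iff_tendstoUniformly`,
`completeSpace_iff_isComplete_range`, `isClosed_iff_forall_filter`,
`IsUniformInducing.comap_uniformity`. Absent at the pin: `CompleteSpace`/`BaireSpace` for
`ContDiffMapSupportedIn` or `SchwartzMap` (searched `CompleteSpace 𝓓`, `CompleteSpace 𝓢`,
`BarrelledSpace` in `Analysis/Distribution`: no hits).

## Design notes

Everything is stated for `n = ⊤` (smooth test functions), the case used downstream; the proof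
for finite `n` is the same with `i ≤ n` bookkeeping. The two new instances (`CompleteSpace`,
`IsCountablyGenerated (𝓤 _)`) do not override any Mathlib instance (Mathlib has none for these
classes on `𝓓_K`); `BaireSpace`/`BarrelledSpace` are left to Mathlib's general instances.
-/

noncomputable section

open Filter Topology Set ContDiffMapSupportedIn
open scoped Distributions Uniformity BoundedContinuousFunction ContDiff

namespace Literature.Analysis.FunctionSpaces

namespace ContDiffMapSupportedIn

variable {E F : Type*} [NormedAddCommGroup E] [NormedSpace ℝ E] [NormedAddCommGroup F]
  [NormedSpace ℝ F] {K : TopologicalSpace.Compacts E}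

/-- **Uniform limits of test functions with all derivatives converging are test functions.**
If along a non-trivial filter `l` the iterated derivatives `Dⁱ (u a)` of test functions
`u a ∈ 𝓓_K` converge in sup norm to bounded continuous `g i`, for every `i`, then some
`f ∈ 𝓓_K` has `Dⁱ f = g i` for all `i` (the closedness step of Rudin (1991), §1.46).
[cite: Rudin1991, §1.46] -/
theorem exists_of_tendsto_iteratedFDeriv {ι : Type*} {l : Filter ι} [l.NeBot]
    (u : ι → 𝓓_{K}(E, F)) (g : (i : ℕ) → E →ᵇ (E [×i]→L[ℝ] F))
    (hg : ∀ i, Tendsto (fun a => structureMapCLM ℝ ⊤ i (u a)) l (𝓝 (g i))) :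
    ∃ f : 𝓓_{K}(E, F), ∀ i, structureMapCLM ℝ ⊤ i f = g i := by
  -- uniform and pointwise convergence of the iterated derivatives
  have hunif : ∀ i,
      TendstoUniformly (fun a x => iteratedFDeriv ℝ i (u a) x) (fun x => g i x) l := by
    intro i
    rw [Metric.tendstoUniformly_iff]
    intro ε hε
    filter_upwards [Metric.tendsto_nhds.1 (hg i) ε hε] with a ha x
    have hx : (structureMapCLM ℝ ⊤ i (u a)) x = iteratedFDeriv ℝ i (u a) x := by
      rw [structureMapCLM_top_apply]
    rw [← hx, dist_comm]
    exact (BoundedContinuousFunction.dist_coe_le_dist x).trans_lt ha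
  have hpt : ∀ i x, Tendsto (fun a => iteratedFDeriv ℝ i (u a) x) l (𝓝 (g i x)) :=
    fun i x => (hunif i).tendsto_at x
  -- the candidate limit and its Taylor series
  set f₀ : E → F := fun x => (g 0 x).curry0 with hf₀
  have hT : HasFTaylorSeriesUpTo (⊤ : ℕ∞) f₀ (fun x i => g i x) := by
    refine ⟨fun x => rfl, fun m _ x => ?_, fun m _ => (g m).continuous⟩
    -- derivatives of the approximants
    have hderiv : ∀ a y, HasFDerivAt (fun y => iteratedFDeriv ℝ m (u a) y)
        ((iteratedFDeriv ℝ (m + 1) (u a) y).curryLeft) y := by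
      intro a y
      have h := (u a).contDiff
      rw [contDiff_iff_ftaylorSeries] at h
      exact h.fderiv m (mod_cast ENat.coe_lt_top m) y
    -- uniform convergence of the (curried) next derivatives
    let Ψ := continuousMultilinearCurryLeftEquiv ℝ (fun _ : Fin (m + 1) => E) F
    have hunif' : TendstoUniformly (fun a y => (iteratedFDeriv ℝ (m + 1) (u a) y).curryLeft)
        (fun y => (g (m + 1) y).curryLeft) l := by
      exact Ψ.toContinuousLinearEquiv.toContinuousLinearMap.uniformContinuous.comp_tendstoUniformly
        (hunif (m + 1))
    exact hasFDerivAt_of_tendstoUniformly hunif' hderiv (hpt m) x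
  have hcd : ContDiff ℝ (⊤ : ℕ∞) f₀ := hT.contDiff
  -- support
  have hsupp : EqOn f₀ 0 (K : Set E)ᶜ := by
    intro x hx
    have h0 : g 0 x = 0 := by
      refine tendsto_nhds_unique (hpt 0 x) ?_
      have : (fun a => iteratedFDeriv ℝ 0 (u a) x) = fun _ => 0 :=
        funext fun a => (u a).iteratedFDeriv_zero_on_compl hx
      rw [this]
      exact tendsto_const_nhds
    simp [hf₀, h0]
  refine ⟨⟨f₀, hcd, hsupp⟩, fun i => ?_⟩
  ext x : 1
  rw [structureMapCLM_top_apply]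
  change iteratedFDeriv ℝ i f₀ x = g i x
  have h := (hasFTaylorSeriesUpToOn_univ_iff.2 hT).eq_iteratedFDerivWithin_of_uniqueDiffOn
    (m := i) (mod_cast le_top) uniqueDiffOn_univ (mem_univ x)
  rw [iteratedFDerivWithin_univ] at h
  exact h.symm

/-- **`𝓓_K` is complete** (a Fréchet space: Rudin (1991), §1.46; Schwartz (1966), Ch. III
§1): the range of the uniform embedding `f ↦ (Dⁱ f)ᵢ` into the complete space
`Π i, E →ᵇ (E [×i]→L[ℝ] F)` is closed. [cite: Rudin1991, §1.46] -/
instance instCompleteSpace [CompleteSpace F] : CompleteSpace 𝓓_{K}(E, F) := by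
  let ΦL : 𝓓_{K}(E, F) →L[ℝ] (i : ℕ) → E →ᵇ (E [×i]→L[ℝ] F) :=
    ContinuousLinearMap.pi (structureMapCLM ℝ ⊤)
  have hΦ : IsUniformEmbedding ΦL := isUniformEmbedding_pi_structureMapCLM ℝ
  rw [completeSpace_iff_isComplete_range hΦ.isUniformInducing]
  apply IsClosed.isComplete
  rw [isClosed_iff_forall_filter]
  intro g ℱ hℱ hℱs hℱg
  set Φ : 𝓓_{K}(E, F) → (i : ℕ) → E →ᵇ (E [×i]→L[ℝ] F) := ⇑ΦL with hΦdef
  have hmem : range Φ ∈ ℱ := hℱs (mem_principal_self _)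
  haveI : (comap Φ ℱ).NeBot := hℱ.comap_of_range_mem hmem
  have htend : Tendsto Φ (comap Φ ℱ) (𝓝 g) := map_comap_le.trans hℱg
  have hg : ∀ i, Tendsto (fun a => structureMapCLM ℝ ⊤ i a) (comap Φ ℱ) (𝓝 (g i)) := fun i =>
    ((continuous_apply i).tendsto g).comp htend
  obtain ⟨f, hf⟩ := exists_of_tendsto_iteratedFDeriv (u := id) g hg
  exact ⟨f, funext hf⟩

/-- The uniformity of `𝓓_K` is countably generated (it is induced by the embedding into a
countable product of normed spaces). [folklore] -/
instance instIsCountablyGenerated_uniformity : (𝓤 𝓓_{K}(E, F)).IsCountablyGenerated := by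
  let ΦL : 𝓓_{K}(E, F) →L[ℝ] (i : ℕ) → E →ᵇ (E [×i]→L[ℝ] F) :=
    ContinuousLinearMap.pi (structureMapCLM ℝ ⊤)
  have hΦ : IsUniformEmbedding ΦL := isUniformEmbedding_pi_structureMapCLM ℝ
  rw [← hΦ.isUniformInducing.comap_uniformity]
  infer_instance

/-- `𝓓_K` is a Baire space and a barrelled space: with `instCompleteSpace` and
`instIsCountablyGenerated_uniformity` in scope, Mathlib's `BaireSpace.of_completelyPseudoMetrizable`
and `BaireSpace.instBarrelledSpace` apply (no new instances are declared for these classes; Rudin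
(1991), §2.2 with §1.46). Recorded as an `example` documenting that the Banach–Steinhaus theorem
`WithSeminorms.banach_steinhaus` is available on `𝓓_K` over any scalar field `𝕜` acting on `F`. -/
example [CompleteSpace F] : BaireSpace 𝓓_{K}(E, F) := inferInstance

example {𝕜 : Type*} [NontriviallyNormedField 𝕜] [NormedSpace 𝕜 F] [SMulCommClass ℝ 𝕜 F]
    [CompleteSpace F] : BarrelledSpace 𝕜 𝓓_{K}(E, F) := inferInstance

end ContDiffMapSupportedIn

end Literature.Analysis.FunctionSpaces
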